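import Literature.NumberTheory.EllipticCurves.ModularCurve
import HarnessLib
import Literature.NumberTheory.EllipticCurves.OpenImageMazurInputs
import Literature.NumberTheory.EllipticCurves.KenkuMinimalLevels
import Literature.NumberTheory.EllipticCurves.ManinConstantIntegral

/-!
# Integrality of the Néron scaling of a rational isogeny between globally minimal models

Literature / elliptic curves. One NAMED FACT (D-0014), in the lattice vocabulary of the tree
(`IsNeronLatticeOf`, `ModularCurve.lean`; Mathlib `PeriodPair`): if `W₀, W'` are GLOBALLY MINIMAL
Weierstrass models over `ℚ` of elliptic curves, with Néron-type period pairs `L₀, L'` (the period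
lattices of the invariant differentials `dx/(2y + a₁x + a₃)` of the two models — for globally minimal
models these are the Néron lattices), and a rational number `q` satisfies `q Λ₀ ⊆ Λ'`, then `q ∈ ℤ`.

Why it is true (and why minimality is needed). For `q ≠ 0` the analytic map `z ↦ qz : ℂ/Λ₀ → ℂ/Λ'`
is an isogeny `φ` which is defined over `ℚ` (the tree's
`Literature.NumberTheory.EllipticCurves.isIsogenous_of_forall_mul_mem_lattice`,
`AnalyticIsogenyDescentProofs`, Silverman *AEC* VI.4.1, VI.5.3 with descent), and by construction
`φ^* ω' = q · ω₀` for the invariant differentials of the two models. Both models being globally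
minimal, `ω₀, ω'` are Néron differentials — generators of the rank-one `ℤ`-modules of invariant
differentials of the Néron models (Silverman *ATAEC* IV.9, Cor. 9.1: the smooth part of a minimal
Weierstrass model is the identity component of the Néron model; Agashe–Ribet–Stein 2006, §§1–2) — and
`φ` extends to a homomorphism of Néron models over `ℤ` (Néron mapping property, *ATAEC* IV.5.1 with
the existence theorem IV.6.1), so `φ^* ω'` is an invariant differential on the Néron model of `W₀`,
i.e. an INTEGRAL multiple of `ω₀`: `q ∈ ℤ`. Without minimality the statement fails (rescaling a
model by `u` rescales its lattice by `u⁻¹`). This is the non-archimedean half of Faltings' Lemma 5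
(`#(ω/φ^*ω') ≥ 1`).

Consumers in the tree (all took it so far as an explicit hypothesis schema, never a named fact):
`hN` of `PastenHeightBoundsIsogenyProofs.neronLatticeHeight_le_add_half_log_degree` (Faltings
height under isogeny), `hInt` of `PastenSpectralDegreeIsogenyBoundProofs.PastenShimura2024_minimalDegree_le_163_mul_of_mazurKenku`
via the optimal pivot of `Summits/ABC/ABC/Cruxes/MazurKenkuBound` (card `optimal-pivot-neron-scaling`),
and the local input of Pasten's Lemma 6.8. Not here: any proof (the tree's point-set isogenies carry no
Néron models; the Néron-model programme `NeronModel*.lean` is scheme-level with no bridge to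
`WeierstrassCurve`/`PeriodPair` yet). The degenerate case `q = 0` is trivially true (`k = 0`) and kept
for the convenience of consumers; the same-model case `W₀ = W'` is elementary (`qΛ ⊆ Λ` forces `q` to be
an algebraic integer) and is proved below as a consistency check (`int_of_rat_mul_mem_lattice_self`).

## References

* J. H. Silverman, *Advanced Topics in the Arithmetic of Elliptic Curves*, GTM 151 (1994): IV.5.1
  (Néron mapping property), IV.6.1, Cor. IV.9.1. [SilvermanATAEC1994]
* S. Bosch, W. Lütkebohmert, M. Raynaud, *Néron Models*, Springer 1990: §1.2 Def. 1, §7.4.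
  [BLRNeronModels1990]
* A. Agashe, K. Ribet, W. A. Stein, *The Manin constant*, Pure Appl. Math. Q. 2 (2006): §§1–2.
  [AgasheRibetStein2006]
* G. Faltings, *Finiteness theorems for abelian varieties over number fields* (transl.), §4 Lemma 5.
* T. Honda, *On the theory of commutative formal groups*, J. Math. Soc. Japan 22 (1970), 213–246:
  Thm. 2 (p. 223), §6.2 Thm. 9 (pp. 240–241) (held: `paper:doi-10-2969-jmsj-02220213`); the singular
  fibres: T. Honda, *Formal groups and zeta-functions*, Osaka J. Math. 5 (1968), Thm. 5. [Honda1970]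
* M. Hazewinkel, *Formal Groups and Applications* (1978), Ch. I §2.2, functional-equation lemma
  (i)–(iv). [Hazewinkel1978]
-/

noncomputable section

namespace Literature.NumberTheory.EllipticCurves

open _root_.WeierstrassCurve ModularForms

/-- **Integrality of the Néron scaling of a rational isogeny between globally minimal models.**
For globally minimal elliptic curves `W₀, W'` over `ℚ` with Néron-type period pairs `L₀, L'`
(`IsNeronLatticeOf`: `g₂ = c₄/12`, `g₃ = c₆/216` of the respective model) and `q ∈ ℚ` with
`q Λ₀ ⊆ Λ'`, the number `q` is an integer: `z ↦ qz` is a `ℚ`-isogeny (`q ≠ 0`) pulling the Néron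
differential `ω'` back to `q ω₀`, and the Néron mapping property makes `φ^*ω'` an integral multiple
of the Néron differential `ω₀` (Silverman *ATAEC* IV.5.1, IV.6.1, Cor. IV.9.1; Agashe–Ribet–Stein 2006
§§1–2: the Néron differential of a globally minimal model is `dx/(2y + a₁x + a₃)`).
[cite: SilvermanATAEC1994, IV.5.1 (Néron mapping property) with IV.6.1 and Cor. IV.9.1]
[cite: AgasheRibetStein2006, §§1–2] -/
def integral_neronScaling_of_isGloballyMinimal : Prop :=
  ∀ (W₀ W' : WeierstrassCurve ℚ) [W₀.IsElliptic] [W'.IsElliptic] [W₀.IsGloballyMinimal]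
    [W'.IsGloballyMinimal] (L₀ L' : PeriodPair),
    IsNeronLatticeOf (W₀.baseChange ℂ) L₀ → IsNeronLatticeOf (W'.baseChange ℂ) L' →
    ∀ q : ℚ, (∀ z ∈ L₀.lattice, (q : ℂ) * z ∈ L'.lattice) → ∃ k : ℤ, (k : ℚ) = q

/-- **Consistency check: the same-lattice case is elementary.** If `q ∈ ℚ` maps a period lattice
into ITSELF, `q Λ ⊆ Λ`, then `q ∈ ℤ`: writing `q = a/b` in lowest terms, `q ω₁ ∈ Λ = ℤω₁ ⊕ ℤω₂`
gives `q ω₁ = m ω₁ + n ω₂`, and linear independence of `ω₁, ω₂` over `ℝ` (hence over `ℚ`) forces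
`n = 0`, `q = m`. (No minimality is involved here; this is the case `W₀ = W'` of the fact.) [folklore] -/
theorem int_of_rat_mul_mem_lattice_self (L : PeriodPair) (q : ℚ)
    (hq : ∀ z ∈ L.lattice, (q : ℂ) * z ∈ L.lattice) : ∃ k : ℤ, (k : ℚ) = q := by
  obtain ⟨m, n, hmn⟩ : ∃ m n : ℤ, (q : ℂ) * L.ω₁ = m * L.ω₁ + n * L.ω₂ := by
    have h := hq L.ω₁ L.ω₁_mem_lattice
    rw [PeriodPair.mem_lattice] at h
    obtain ⟨m, n, h⟩ := h
    exact ⟨m, n, by rw [← h]⟩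
  -- `(q - m) ω₁ - n ω₂ = 0` with `ω₁, ω₂` linearly independent over `ℝ`
  have hli := L.indep
  have key : ((q : ℝ) - m) • L.ω₁ + (-(n : ℝ)) • L.ω₂ = 0 := by
    simp only [Complex.real_smul, Complex.ofReal_sub, Complex.ofReal_ratCast, Complex.ofReal_intCast,
      Complex.ofReal_neg]
    linear_combination hmn
  have h2 := (LinearIndependent.pair_iff.mp hli) ((q : ℝ) - m) (-(n : ℝ)) key
  refine ⟨m, ?_⟩
  have : (q : ℝ) = m := by linarith [h2.1]
  exact_mod_cast this.symm

end Literature.NumberTheory.EllipticCurves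

end

/-! ## Relocated from `Summits/ABC/ABC/Theorems/IsogenyGlueCongruenceMazurKenkuBoundProp51AndFourFacts.lean` (gate, accept-time relocation of cited facts) — AgasheRibetStein2006, EdixhovenManin1991 -/

namespace Literature.NumberTheory.EllipticCurves

open scoped MatrixGroups ModularForm NNReal NumberField Classical
open CongruenceSubgroup
open WeierstrassCurve
open IsDedekindDomain Field
open Literature.NumberTheory.EllipticCurves
open Literature.NumberTheory.EllipticCurves.ModularForms
open Literature.NumberTheory.GaloisRepresentations
open Literature.NumberTheory.Automorphic

/-! ### Status of `edixhoven_int_of_neronLattice_eq_smul_periodLattice` (literature-prover census, 2026-08-16)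

Undischarged and kept as a cited named fact: three provefact sessions found no proof route inside
the tree's present vocabulary. Recorded for the routes that consume it as the hypothesis `hEd`
(`Summit.ABC.ABC.Theorems.polyDegreeOfBoundedPrimes_iff_polyHeight_of_facts`,
`…MazurKenkuBoundProp51AndFourFacts`), so that it is priced as what it is.

* **Source and faithfulness.** Agashe–Ribet–Stein 2006 print it as "Theorem 2.2 (Edixhoven
  [Edi91, Prop. 2]). The constant `c_E` is an integer. Edixhoven proved this using an integral
  `q`-expansion map, whose existence and properties follow from results in [KM85]" (p. 619), and
  Cremona's appendix to the same paper gives the lattice form used here: "Pulling back the Néron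
  differential on `E_{j₀}` to `X₀(N)` gives `c · 2πi f(z) dz` where `c ∈ ℤ` is the Manin constant
  for `f`. Hence `cΛ_f = Λ_{j₀}`" (p. 632). The tree proves the named fact EQUIVALENT to the
  integral-equation form — every `Λ_{D.f}` is the Néron-type lattice of a Weierstrass equation
  over `ℤ` (`Literature.NumberTheory.Automorphic.edixhovenFact_iff_integralModel`) — and, jointly
  with the Modularity theorem, to `exists_optimal_modularParametrizationData`
  (`exists_optimal_modularParametrizationData_iff_exists_isNewformOf_and_edixhovenFact`); so it is
  neither weaker nor stronger than the printed Prop. 2.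
* **Inputs of the printed proof and their state in the tree.** `φ : X₀(N)_ℚ → E` extends over
  the smooth locus of `X₀(N)_ℤ` by the Néron mapping property, so `φ^*ω` is a section of `Ω¹`
  along the cusp section `∞`, whose `q`-expansion lies in `ℤ⟦q⟧dq/q`; as `φ^*ω = c · f dq/q` and
  `a₁(f) = 1`, `c ∈ ℤ` (Agashe–Ribet–Stein 2006, proof of Thm. 3.4). (M1) a model of `X₀(N)`
  over `ℤ` smooth along `∞` with the `q`-expansion principle (Katz–Mazur 1985; Katz 1973, §1.6) —
  absent (`Y0`, `X0Points` of `ModularCurve.lean` are topological quotients); (M2) Néron models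
  with the mapping property — the named fact
  `Literature.NumberTheory.EllipticCurves.exists_isNeronModel` (`NeronModel.lean`), unproved;
  (M3) the smooth part of a minimal Weierstrass model is the identity component of the Néron
  model, so the Néron differential is `dx/(2y + a₁x + a₃)` (Silverman, *ATAEC*, Cor. IV.9.1) —
  absent (no scheme over `ℤ` attached to a Weierstrass equation); (M4) the optimal quotient map
  is a `ℚ`-morphism with `φ^* dz = 2πi f dτ` (Shimura 1971, Thm. 7.14) — absent (the tree's
  parametrisation, `ModularParametrizationData`, is analytic).
* **Where the tree's analytic theory stops.** For a prime `p ≥ 5`, `v_p(q) ≥ 0` in the fact is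
  equivalent to the `p`-integrality of `12 g₂(Λ_f)` and `216 g₃(Λ_f)` (minimality of `W'` at `p`
  together with `12 g₂(Λ_f) = q⁴ c₄(W')`, `216 g₃(Λ_f) = q⁶ c₆(W')`, as `Λ' = qΛ_f`), i.e. of two
  `q`-expansion coefficients of the weight-`0` modular function `x = ℘_{Λ_f}(2πi∫f)` of
  `ModularParamXFunction`: from the Laurent expansion of `℘`,
  `12 g₂(Λ_f) = 240·[q²]x + 96a₅ − 180a₂a₄ − 80a₃² + 240a₂²a₃ − 75a₂⁴` (check on `11a1`, where
  `c = 1` and `x = q⁻² + 2q⁻¹ + 4 + 5q + 8q² + q³ + 7q⁴ − 11q⁵ + ⋯`: `240·8 − 1424 = 496 = c₄`).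
  The tree has `g₂(Λ_f), g₃(Λ_f) ∈ ℚ` (`PeriodPair.ratCast_g₂_g₃_of_lattice_eq_periodLattice`)
  and bounded denominators of `x` OFF the finitely many primes dividing a leading coefficient
  (`ModularParamIntegralityProofs`), and nothing at the remaining primes; no more is true of a
  general meromorphic modular function with rational expansion at `∞` (the level-one function
  `1/(j − 1/2) ∈ qℚ⟦q⟧` has unbounded powers of `2` in its denominators: its pole `{j = 1/2}`
  meets the cusp in the fibre at `2`). The missing input is exactly that the pole divisor of
  `x ∘ φ` does not meet `∞` in any fibre of `X₀(N)_ℤ`, which is (M1) + (M2) + (M4); in the formal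
  group of the minimal model it reads `t ∘ φ = [c](u(q))` with `u ∈ ℤ⟦q⟧` (Honda 1968, Thm. 5;
  Hill 1971), so that `v_p(c) ≥ 0` iff `t ∘ φ` has `p`-adically bounded coefficients — an
  arithmetic statement about `X₀(N)` at `p`, not an analytic one.
-/

/-! ### A finite-height refinement of the status above (literature-prover analysis from the seat of
`Literature.NumberTheory.Automorphic.exists_optimal_modularParametrizationData`, 2026-08-16; a road
map, of which the case of a GOOD prime `p ≥ 5` is now a theorem of the tree — last bullet)

Write `c` for the rational number `q` of the statement below (so that `q` is the nome) and `t'`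
for the parameter `−x/y` of `W'` along the parametrisation. The last bullet above is sharp for a
GENERAL meromorphic modular function, but `t'` is not general: at every prime `p` where Honda's
theorem holds for `W'` alone, `[pᵐ]_{Ŵ'}(t') ∈ ℤ_p⟦q⟧` for `m ≫ 0`, and at a prime where `Ŵ'` has
FINITE HEIGHT this upgrades mere membership in `Frac ℤ_p⟦q⟧` — which the tree has — to
integrality.

* **Local lemma.** Let `O` be a complete discrete valuation ring (uniformiser `ϖ`, fractions
  `K`), `A = O⟦q⟧`, `F` a one-dimensional formal group law over `O` with `[p]_F ≢ 0 (mod ϖ)`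
  (finite height `h`), and `z ∈ qK⟦q⟧` with `z · Q = P` for some `P, Q ∈ A`, `Q ≠ 0`, and
  `w := [pᵐ]_F(z) ∈ A` for some `m`. Then `z ∈ A`. Proof: `S(X) = [pᵐ]_F(X) − w ∈ A⟦X⟧` has its
  coefficients of degree `< n = p^{mh}` in `𝔪_A = (ϖ, q)` and a unit coefficient in degree `n`,
  and `A` is `𝔪_A`-adically complete, so Weierstrass preparation at `𝔪_A`
  (`Literature.RingTheory.HenselLemma.exists_isWeierstrassFactorizationAt`) gives `S = M · U` with
  `M ∈ A[X]` monic of degree `n` and `U` a unit; substituting `X ↦ z` (`q`-adically convergent)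
  gives `M(z) = 0`, so `z ∈ Frac A` is integral over `A`; and `A` is factorial (one-variable
  preparation over `O`: the irreducibles are `ϖ` and the irreducible distinguished polynomials
  `π`, which are prime because `A/(π) ≅ O[q]/(π) ↪ K[q]/(π)`), hence integrally closed. The lemma
  is false at infinite height (`F = 𝔾_a`, `z = q/p`); at height one it says e.g.
  `(1 + q)^{1/p} − 1 = [p⁻¹]_{𝔾_m}(q) ∉ Frac ℤ_p⟦q⟧`. [folklore]
* **Its inputs for this fact, at a prime `p` of good or multiplicative reduction of `W'`.** With
  `L` a period pair of `Λ_f = c⁻¹Λ'` and `E_L : Y² = X³ + a₄X + a₆` the short model with lattice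
  `Λ_f` (`g₂(Λ_f), g₃(Λ_f) ∈ ℚ`, `PeriodPair.ratCast_g₂_g₃_of_lattice_eq_periodLattice`), the tree
  gives `z_L ∈ qℚ⟦q⟧ ∩ Frac ℤ⟦q⟧` with `log_{E_L}(z_L) = Σ aₙqⁿ/n =: ℓ(q)`
  (`IsXPresentation.exists_formalLog_subst_eq`, `IsXPresentation.exists_int_series_of_mul_yFn_eq`);
  the `ℚ`-isomorphism `E_L ≅ W'` (scaling `u = ±c^{±1}`) is affine on `(x, y)`, so `t' = −x'/y'`
  again lies in `qℚ⟦q⟧ ∩ Frac ℤ⟦q⟧`, with `log_{Ŵ'}(t') = ±c · ℓ(q)`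
  (`WeierstrassCurve.formalLog_variableChange_subst`). Here `aₙ = aₙ(f) = aₙ(W')` by `IsNewformOf`,
  so `ℓ` is the logarithm of the `L`-series formal group of `W'` ITSELF, and Honda's theorem —
  `log_{Ŵ'}` and `ℓ` have the same type, `p − a_pT + T²` at a good prime and `p − a_pT` at a
  multiplicative one, so that `exp_{Ŵ'} ∘ ℓ ∈ ℤ_p⟦T⟧` (Honda 1970, Thm. 2, p. 223, and Thm. 9,
  pp. 240–241, the singular fibres being Honda 1968 = his [10], Thm. 5; Hazewinkel 1978, I.2.2,
  functional-equation lemma (ii)) — makes `[pᵐ](t') = [±pᵐc]_{Ŵ'}(exp_{Ŵ'}(ℓ(q))) ∈ ℤ_p⟦q⟧` for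
  `m ≥ −v_p(c)`. The lemma then gives `t' ∈ ℤ_p⟦q⟧`, i.e. `±c = [q¹]t' ∈ ℤ_p`. Consequently
  `v_p(c) ≥ 0` at every good or multiplicative prime of `W'`, and the fact holds for every
  SEMISTABLE `W'` — with no model of `X₀(N)` over `ℤ` and no Néron model; the modular input is
  only `t' ∈ Frac ℤ⟦q⟧` (Shimura's Thm. 3.52, as used in `ModularParamIntegralityProofs`).
  In the tree: the type of `log_{Ŵ'}` at good ODD `p`
  (`WeierstrassCurve.norm_coeff_hondaShift_formalLog_le_one`), the type of `ℓ` from the Hecke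
  recursion and the functional-equation lemma (iii), (iv) (`RingTheory/FormalGroups/HondaTypeTransport`)
  are theorems, and so are the two algebraic inputs of the lemma — the `(ϖ, q)`-adic completeness
  of `O⟦q⟧` (`Literature.NumberTheory.GaloisRepresentations.powerSeries_isAdicComplete_maximalIdeal`,
  in `PotentialDiagonalizabilityCriteriaProofs`) and the factoriality of `O⟦q⟧` (Mathlib's instance
  `UniqueFactorizationMonoid R⟦X⟧` for a principal ideal domain `R`, `RingTheory/PowerSeries/Ideal`,
  whence `IsIntegrallyClosed ℤ_[p]⟦X⟧` by `inferInstance`); since then (m1) the local lemma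
  (`Literature.RingTheory.PowerSeries.exists_map_eq_of_subst_eq_map`,
  `padicInt_exists_map_eq_of_subst_eq_map`, file `RingTheory/PowerSeries/WeierstrassRootIntegrality`)
  and (m2) lemma (ii) (`Literature.RingTheory.FormalGroups.norm_coeff_le_one_of_subst_eq`, file
  `RingTheory/FormalGroups/HondaTypeFunctionalEquationII`) have landed, together with the finite
  height of `Ŵ'` at a good odd prime (`WeierstrassCurve.formalMul_map_toZMod_ne_zero`,
  `FormalGroupFiniteHeightProofs`) and Honda's Thm. 9 at one good odd prime
  (`WeierstrassCurve.exists_padicInt_formalLog_subst_eq_lSeriesLog`, `HondaStrongIsomorphismProofs`);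
  (m3) the types at a multiplicative prime (one-term; the nodal formal group is a form of `𝔾̂_m`,
  `[p]˜ = [a_p] ∘ Frob`) have landed since (`NodalReductionHondaTypeProofs`,
  `HondaStrongIsomorphismMultiplicativeProofs`, last bullet); NOT yet in the tree are the types at
  good `p = 2` (Hasse–Manin in characteristic `2`), and (m4) the transport of the hypotheses of the
  fact to `(t', c, ℓ)` in general — done so far only through the short model, which costs `p ≥ 5`
  (last two bullets).
  [cite: Honda1970, Thm. 2 (p. 223) and Thm. 9 (pp. 240–241)]
* **What it does not reach: the additive primes (`p² ∣ N`).** There `Ŵ' ⊗ 𝔽_p` is a form of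
  `𝔾̂_a`, `[p] ≡ 0 (mod p)`, the reduction of `S` vanishes and the lemma is unavailable (and false
  abstractly). Over a finite `K/ℚ_p` where `W'` acquires semistable reduction, with minimal model
  `W'' = ψ_u W'` and `ν := v_p(u) = (v_p(Δ(W')) − v_p(Δ(W'')))/12`, the lemma over `O_K⟦q⟧` bounds
  only `v_p(uc) ≥ 0`, i.e. `v_p(c) ≥ −ν`, which settles the prime iff `ν < 1`: every additive
  `p ≥ 5` (`ν ≤ 10/12`, resp. `ν = 1/2` in the potentially multiplicative case), but not the
  Kodaira types with `v_p(Δ(W')) − v_p(Δ(W'')) ≥ 12` at `p = 3` (`III*`, `II*`) and `p = 2`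
  (`I₀*`, `IV*`, `III*`, `II*`, `Iₙ*`); the sharp form of the bound (`v_p(uc) ≥` the largest
  valuation of a nonzero torsion point of `Ŵ''`, at least `1/(pʰ − 1)`) settles `p = 3` and all of
  `p = 2` except `II*` with conductor exponent `8` and potentially supersingular reduction of torsion
  valuation exactly `1/3`, which stays undecided. Either way the detour needs finite extensions of
  `ℚ_p` and explicit (at `p = 2, 3` wild) semistable models. So for the fact as stated (all `W'`)
  the inputs (M1)–(M4) above remain the only complete route known here; the refinement isolates
  the additive primes as the difficulty.
* **Proved: the good primes `p ≥ 5`.** For the exact data of the fact below and a prime `p ≥ 5`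
  with `p ∤ Δ_min(W')`, `‖q‖_p ≤ 1`
  (`Literature.NumberTheory.EllipticCurves.padicNorm_le_one_of_neronLattice_eq_smul_periodLattice`,
  file `ManinConstantGoodPrimesProofs`; corollary `dvd_of_dvd_den_of_neronLattice_eq_smul_periodLattice`:
  every prime factor of `den q` divides `6 Δ_min(W')`). The transport (m4) is done there by the
  scaling `S = (u, 0, 0, 0)`, `u = u(C)` for `C • E_L = W'` (`‖u‖_p = ‖q‖_p`): `S • E_L` is the
  short model `toShortNF • W'`, `p`-integral for `p ≥ 5`, and the local lemma is applied to
  `[den u]_{Ŵ'} ∘ θ₀` at `u·z_L` (`θ₀ : (S • E_L)^ ⥲ Ŵ'`, `u(θ₀) = 1`), avoiding `t' ∈ Frac ℤ⟦q⟧`;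
  good `p = 3` would need that membership (the `x, y`-dictionary for `z_L`), good `p = 2` and the
  multiplicative primes need (m3). [cite: EdixhovenManin1991, Prop. 2]
* **Proved: the multiplicative primes `p ≥ 5`** ((m3), one-term types). For the exact data of the
  fact below and a prime `p ≥ 5` with `p ∣ Δ_min(W')`, `p ∤ c₄(W')`, `‖q‖_p ≤ 1`
  (`Literature.NumberTheory.EllipticCurves.padicNorm_le_one_of_neronLattice_eq_smul_periodLattice_of_dvd_of_not_dvd`,
  file `ManinConstantMultiplicativePrimesProofs`); hence `‖q‖_p ≤ 1` at every `p ≥ 5` that is not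
  additive (`…_of_not_additive`), every prime factor of `den q` is `2`, `3` or a prime of additive
  reduction (`dvd_six_or_additive_of_dvd_den_of_neronLattice_eq_smul_periodLattice`), and for a
  semistable `W'` the denominator of `q` is a `{2, 3}`-number
  (`eq_two_or_eq_three_of_dvd_den_of_semistable`). The inputs at a multiplicative `p`, obtained
  without Tate's uniformisation: the formal group of the origin-nodal cubic `y² + a₁xy − a₂x² = x³`
  with tangent slopes `α, β` is conjugate to `𝔾̂_m` by `Φ = (1 + αz)/(1 + βz)` (`Φ([n]) = Φⁿ`,
  file `NodalCubicFormalGroupProofs`), so `[p]˜ = zᵖ` (split node) resp. `ĩ(zᵖ)` (non-split) after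
  moving the `𝔽_p`-rational node of `W' ⊗ 𝔽_p` to the origin, whence Honda's congruence
  `hondaShift p (±(1+p)) log_{W'} ∈ ℤ_p⟦z⟧` (type `p ∓ T`; `NodalReductionHondaTypeProofs`), the
  finite height `[p]˜ ≠ 0` (from the congruence: `formalMul_prime_map_toZMod_ne_zero_of_hondaShift`),
  the sign `a_p(W') = ±1` read on the node-tangent quadratic of the minimal model mod `p` with
  `a_{pm} = a_p a_m`, and Honda's strong isomorphism `Σ aₙ(W')zⁿ/n = log_{W'}(ψ)`, `ψ ∈ zℤ_p⟦z⟧`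
  (`WeierstrassCurve.exists_padicInt_formalLog_subst_eq_lSeriesLog_of_dvd_of_not_dvd`, file
  `HondaStrongIsomorphismMultiplicativeProofs`; Honda 1968 Thm. 5, 1970 Thm. 9). What remains for
  the fact as stated: `p = 2, 3` of finite height (the short-model transport) and the additive
  primes (previous bullet). [cite: EdixhovenManin1991, Prop. 2] [cite: Honda1970, Thm. 9 (pp. 240–241)]
* **Proved: the additive primes `p ≥ 5` — hence every prime `p ≥ 5`: `den q ∣ 6^∞`.** For the
  exact data of the fact below and a prime `p ≥ 5` with `p ∣ Δ_min(W')`, `p ∣ c₄(W')`, `‖q‖_p ≤ 1`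
  (`Literature.NumberTheory.EllipticCurves.padicNorm_le_one_of_neronLattice_eq_smul_periodLattice_of_dvd_of_dvd`,
  file `ManinConstantAdditivePrimesProofs`); so `‖q‖_p ≤ 1` at EVERY `p ≥ 5` (`…_of_five_le`) and
  every prime factor of `den q` is `2` or `3` (`dvd_six_of_dvd_den_of_neronLattice_eq_smul_periodLattice`,
  `eq_two_or_eq_three_of_dvd_den_of_neronLattice_eq_smul_periodLattice`,
  `exists_six_pow_mul_mem_int_of_neronLattice_eq_smul_periodLattice`: `6ᵐ q ∈ ℤ`) — Edixhoven's
  integrality away from `6`, without Néron models. The "additive primes" bullet above is thereby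
  settled for `p ≥ 5`, and WITHOUT Honda theory over a ramified ring: at an additive prime the short
  model `E₀ = toShortNF • W'` reduces to the cuspidal cubic `y² = x³` (`𝔾̂ₐ`, `[p]˜ = 0`), and
  over the UNRAMIFIED ring `ℤ_p` infinite height forces `log_{E₀}, exp_{E₀} ∈ ℤ_p⟦z⟧`
  (`FormalGroupInfiniteHeightProofs`: `[p] = p·g`, compare coefficients in `log([p]z) = p·log z`),
  while `Σ aₙzⁿ/n ∈ ℤ_p⟦z⟧` because `aₙ = 0` for `p ∣ n`; so the Honda witness `ψ = exp_{E₀}(ℓ)` is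
  free and `[den u]_{E₀}(u z_L) ∈ ℤ_p⟦z⟧` as before. Finite height is restored on the twist
  `V'' = (πᵏ, 0, 0, 0) • E₀` over `O = 𝒪_{ℚ_p(π)}`, `π¹² = p`, with `k = v_p(Δ) < 12` (potentially
  good) resp. `k = 6` (potentially multiplicative, `v_p(c₄) = 2`, `v_p(c₆) = 3`) by minimality
  (`WeierstrassCurve.exists_semistableTwistData`, file `AdditiveReductionSemistableModelProofs`;
  `O` is a complete discrete valuation ring: `GaloisRepresentations/PadicCoeffRingDVRProofs`), and the
  local lemma — stated for any complete local principal ideal domain — applies to `z'' = πᵏ u z_L`: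
  `πᵏu ∈ O` with `k < 12` and `‖u‖_p ∈ p^ℤ` give `‖u‖_p ≤ 1`. What remains for the fact as stated:
  `p = 2, 3` (of finite height: the short-model transport; additive: the Kodaira types with `ν ≥ 1`
  listed above). [cite: EdixhovenManin1991, Prop. 2] [cite: Honda1970, Thm. 2 (p. 223)]
* **Proved: the inputs (i) and (ii) at a GOOD prime `p = 2`** (lead c17 of crux stmt-ABC-15125,
  2026-08-16, p128372 / p128471 / p128573). The "types
  at good `p = 2`" of bullet (m2)–(m3) were missing only because the dictionary
  `laurentPt_formalGroupLaw / laurentPt_formalMul` (`FormalGroupLaurentPoints`) was proved for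
  `char k ≠ 2` — used solely in the tangent case, to see `Ỹ(σ) = (a₁σ − 2)X(σ) + a₃σ³ ≠ 0`; in
  characteristic `2`, `Ỹ(σ) = σ(a₁X(σ) + a₃σ²) ≠ 0` by ellipticity (`a₁ = a₃ = 0 ∧ 2 = 0 ⇒ Δ = 0`),
  and `HasseManin.frob_relation` already covers characteristic `2`. Hence, at EVERY prime `p`:
  the characteristic-free dictionary `WeierstrassCurve.laurentPt_formalGroupLaw' / laurentPt_formalMul'`
  (file `FormalGroupLaurentPointsAllCharProofs`); Honda's congruences
  `WeierstrassCurve.norm_coeff_hondaShift_formalLog_le_one'` and the finite height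
  `formalMul_prime_map_toZMod_ne_zero'`, `exists_isUnit_coeff_formalMul_subst'` (input (i); file
  `FormalGroupFrobeniusTypeAllPrimesProofs`); and for a globally minimal `W` with `p ∤ Δ_min(W)` the
  type `norm_coeff_hondaShift_subst_formalLog_le_one'`, its transported form
  `norm_coeff_hondaShift_formalLog_subst_of_variableChange'`, and Honda's strong isomorphism
  `WeierstrassCurve.exists_padicInt_formalLog_subst_eq_lSeriesLog'` (input (ii); file
  `HondaStrongIsomorphismAllPrimesProofs`). So at a good `p = 2` (and a good `p = 3`, already covered
  by the unprimed theorems) only the short-model-free transport (m4) is missing; at a multiplicative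
  `p = 2, 3` likewise, the one-term types of `NodalReductionHondaTypeProofs` /
  `HondaStrongIsomorphismMultiplicativeProofs` carrying no parity hypothesis.
  [cite: Honda1970, Thm. 9 (pp. 240–241)] [cite: SilvermanAEC2009, Thm. V.2.3.1(b) and App. A Prop. 1.1]
* **Proved: (m4) model-free, and with it EVERY prime that is not additive, `p = 2, 3` included —
  hence the fact for every `W'` with `v₂(N) ≤ 1`, `v₃(N) ≤ 1` (in particular every semistable
  `W'`)** (2026-08-16, p128836 / p129067). The `x,y`-DICTIONARY
  (`ModularParamFormalDictionaryProofs`): the proof of `formalLog_subst_eq_of_ode` already shows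
  `b·X_E(z_L) = z_L²·a` for the pole-cleared coordinate `X_E = formalXMulSq` (`x = a/b`), and
  `X_E·w = z³`, so **`a·w_E(z_L) = b·z_L`**, i.e. `w_E(z_L(q)) = −1/Y(q)`: the formal point
  `(z_L, w_E(z_L))` IS the point `(X(q), Y(q))` (`IsXPresentation.exists_formalLog_subst_eq_formalW`).
  Hence `w_E(z_L) ∈ Frac ℤ⟦q⟧` too (`exists_rat_series_formalLog_subst_eq_formalW`), and for ANY
  change of variables `C = (u, r, s, t)` over `ℚ` the parameter `t' = θ_C(z_L) = u(z_L − r w)/(1 + sz_L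
  + (t − sr)w)` of `C • E_L` lies in `Frac ℤ⟦q⟧ ∩ qℚ⟦q⟧` with an explicit witness
  (`WeierstrassCurve.exists_int_frac_formalVariableChange_subst`), `log_{W'}(t') = u·Σ aₙqⁿ/n`,
  `[X¹]t' = u`. The local lemma is then applied to `g = [den u]_{W'}` ITSELF at `t'` — no model of
  `W'` but its minimal equation enters, no `p ≥ 5`
  (`Literature.NumberTheory.EllipticCurves.padicNorm_le_one_of_neronLattice_eq_smul_periodLattice_of_formalMul_ne_zero'`,
  file `ManinConstantFiniteHeightPrimesProofs`: `‖q‖_p ≤ 1` at ANY prime given finite height and a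
  Honda witness). With the inputs of the previous bullets: `‖q‖_p ≤ 1` at every GOOD prime, all `p`
  (`…_of_not_dvd'`), every MULTIPLICATIVE prime, all `p` (`…_of_dvd_of_not_dvd'`), every
  non-additive prime (`…_of_not_additive'`), and — with the additive `p ≥ 5` — at every prime except
  possibly an ADDITIVE `p ∈ {2, 3}` (`…_of_imp`); every prime factor of `den q` is an additive prime
  `2` or `3` of `W'` (`lt_five_and_additive_of_dvd_den_…`,
  `eq_two_or_eq_three_and_additive_of_dvd_den_…`); and **`q ∈ ℤ`** — the conclusion of the fact —
  whenever the reduction of `W'` at `2` and at `3` is not additive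
  (`Literature.NumberTheory.EllipticCurves.int_of_neronLattice_eq_smul_periodLattice_of_not_additive_two_three`,
  `…_of_semistable`). WHAT REMAINS of the fact as stated: exactly the additive primes `p = 2` and
  `p = 3` (`4 ∣ N` or `9 ∣ N`): infinite height there is again free ([p]˜ = 0 after an
  `𝔽_p`-rational change of coordinates with `u = 1` bringing the cuspidal cubic to `y² = x³`, also
  for `p = 2, 3`), so `log_{W'}, exp_{W'} ∈ ℤ_p⟦z⟧` and the Honda witness is free; what is missing
  is finite height on a semistable model over a (for `p = 2, 3` possibly WILD) extension `O/ℤ_p` with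
  the twist exponent `ν < 1` — see the "additive primes" bullet for the types where even the sharp
  bound fails. [cite: EdixhovenManin1991, Prop. 2] [cite: Honda1970, Thm. 9 (pp. 240–241)]
  [cite: SilvermanAEC2009, IV.1]
* **Proved: infinite height and the free Honda witness at EVERY additive prime, `p = 2, 3`
  included** (2026-08-16, p129659, file `CuspidalReductionInfiniteHeightProofs`): a cuspidal
  Weierstrass cubic over `𝔽_p` is `(1, r, s, t)`-isomorphic over `𝔽_p` to `y² = x³`
  (`WeierstrassCurve.exists_variableChange_eq_zero_of_cuspidal`; `p = 2`: `c₄ = a₁⁴`, `Δ = a₃⁴`,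
  cusp `(a₄, a₂a₄ + a₆)`; `p = 3`: `c₄ = b₂²`, `Δ = −a₄³`, `a₆ = a₆³`), whence for ANY `V/ℤ_p` with
  cuspidal reduction `[p]˜_V = 0` (`formalMul_prime_map_toZMod_eq_zero_of_cuspidal`: lift the change
  of variables to `ℤ_p`, `[p]' ∘ θ = θ ∘ [p]` by equal logarithms, reduce), and for a globally
  minimal `W` at a prime `p ∣ Δ_min`, `p ∣ c₄`, every `p`: `[p]˜ = 0`
  (`formalMul_prime_map_toZMod_eq_zero_of_dvd_of_dvd`), `log_W ∈ ℤ_p⟦z⟧`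
  (`norm_coeff_formalLog_le_one_of_dvd_of_dvd`), and input (ii) for the minimal model itself:
  `Σ aₙ(W)zⁿ/n = log_W(ψ)`, `ψ ∈ zℤ_p⟦z⟧`
  (`WeierstrassCurve.exists_padicInt_formalLog_subst_eq_lSeriesLog_of_dvd_of_dvd`). NEXT (planned,
  same hands): the model-free semistable-twist step over a general `O = 𝒪_E`, `E/ℚ_p` finite —
  given `C = (πᵏ, r, s, t)`, `r, s, t ∈ O`, with `C • (W' ⊗ E)` `O`-integral of finite-height
  reduction, and `k·J < e·J + k` for some `J` with `[z^J][p]_{C•W'}` a unit (`k < e` suffices), then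
  `‖q‖_p ≤ 1` — by the dictionary transport of `t'` to `t'' = θ_C(t')` in `Frac O⟦q⟧`, the local
  lemma over `O`, and (for `k ≥ e`) the Newton polygon of `[p]` on `O⟦q⟧` with its Gauss valuation;
  this reduces the additive `p = 2, 3` to exhibiting the (Kraus) semistable models type by type.
  [cite: SilvermanAEC2009, Prop. III.2.5 and App. A Prop. 1.1–1.2] [cite: Honda1970, Thm. 2 (p. 223)]
* **Proved: the Newton-polygon (sharp / vertex) ender, and the global and local halves of the
  capstone in isolation** (2026-08-16, p131666, file `ManinConstantSemistableTwistSharpProofs`, the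
  seat of `exists_optimal_modularParametrizationData`; concurrent with and equivalent in strength to
  `ManinConstantSemistableTwistWildProofs`): `norm_coeff_mul_pow_le_of_subst_eq_rescale` (over any
  ultrametric field: `B(Φ(X)) = Φ(cX)`, `Φ` integral with maximal coefficient norm `M` attained, `B`
  integral with `‖b_J‖ = 1` ⇒ `‖b_j‖Mʲ ≤ ‖c‖M` for all `j ≥ 1`), `exists_index_norm_coeff_max`,
  `Padic.norm_le_one_of_pow_mul_pow_mul_norm_pow_le`;
  `exists_formalParam_of_neronLattice_eq_smul_periodLattice` (Steps 1–4: `u = ±q > 0`, `t₀`, the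
  `Frac ℤ⟦X⟧`-witnesses) and `exists_integral_param_of_semistableTwist` (Steps 5–9: `t₃ ∈ O⟦X⟧`,
  `[X¹]t₃ = πᵏu`, `log_{V''}t₃ = πᵏu·ℓ`) — the exports (β′) asked for in the next bullet;
  `padicNorm_le_one_of_integral_param` (Step 10: `Φ = t₃ ∘ ℓ⁻¹`, `[p]_{V''}Φ = Φ(pX)`), and the
  enders `…_of_semistableTwist_vertex / _sharp` (local and for the data of the fact at an additive
  prime): `k < e` replaced by a unit coefficient `b_J` (finite height) plus a vertex `‖b_j‖ ≥ ‖π‖ᵛ`,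
  `j ≥ 1`, with `(j − 1)k + v < je` (`_sharp`: `v = 0`, `j = J`). LANDED next (same seat,
  2026-08-17, p132786, file `ManinConstantPotMultiplicativeProofs`): the POTENTIALLY MULTIPLICATIVE
  additive types at EVERY `p` (`Iₙ*`, `n ≥ 1`, at `3`; the `v₂(j) < 0` types at `2`):
  `K = ℚ_p(√(−c₄/c₆))`, the `p`-integral model `E_j = (1, 0, 0, −36/(j−1728), −1/(j−1728))`,
  `W' ⊗ K = D • E_j` by proportional invariants (`exists_variableChange_of_c₄_eq_of_c₆_eq'`, any
  field of characteristic `0`), integrality of `r, s, t` between `O`-models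
  (`norm_rst_le_one_of_variableChange_eq`: Silverman VII.1.3(d) over any ultrametric field, by
  `‖r‖ = ‖4r − 3r‖`), `V'' = (w⁻¹, 0, 0, 0) • E_j` with nodal reduction
  `y² + w̄xy = x³ = nodalCubicOfSlopes (−w̄) 0`, whose `[p]˜` vanishes below degree `p` and has
  `[zᵖ] = (−w̄)^{p−1} ∈ k^×` (`coeff_formalMul_prime_nodalCubicOfSlopes`, any field of
  characteristic `p`), so `J = p`, `4k = e·v_p(c₄)` (`exists_nodalTwist_of_one_lt_norm_j`), and
  `(p − 1)k < pe` iff `(p − 1)v_p(c₄) < 4p` — automatic at `2` and `3` by the Kraus bounds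
  (`padicNorm_le_one_of_neronLattice_eq_smul_periodLattice_of_one_lt_norm_j`, `…_two`, `…_three`).
  LANDED then (p133178, file `FormalMulThreeHeightDichotomyProofs`): **`[3]` in characteristic `3`**
  — `[z³][3] = b₂ = A₃` (ordinary) and, when `b₂ = 0`, `[3](z) = ±b₈z⁹ + O(z¹⁰)` with
  `b₈ = −b₄² ≠ 0` (read off the tree's division-polynomial identity
  `sum_ΨSq_mul_formalXMulSq_subst_formalMul` with `ΨSq₃ = Ψ₃² = b₈²` CONSTANT — no isogenies, no
  Frobenius), whence the ender
  `padicNorm_le_one_of_neronLattice_eq_smul_periodLattice_of_goodTwist_three`: ANY twist datum at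
  `3` whose `O`-model `V''` has GOOD reduction and `8k < 9e` gives `‖q‖₃ ≤ 1` (`J = 3` or `J = 9`);
  for a twist acquiring good reduction `12k = e·v₃(Δ_min) ≤ 13e` (Kraus), so `8k < 9e` always, and
  the torsion-valuation step (τ) of the next bullet is NOT needed at `3`. LANDED last (p133828,
  file `ManinConstantLegendreTwistProofs`): the good twist at `3` itself (σ₃) —
  `K = ℚ₃(e₁, e₂, e₃, √(e₂ − e₁))` (`eᵢ` the roots of `4x³ + b₂x² + 2b₄x + b₆`, Mathlib `Cubic`
  Vieta API), `D = (√(e₂ − e₁), e₁, −a₁/2, −(a₃ + e₁a₁)/2)`, `D • (W' ⊗ K) = y² = x(x − 1)(x − λ)`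
  (`legendre_smul_eq`), `λ, 1 − λ ∈ O^×` from `‖j‖₃ ≤ 1`, `V'' = (w⁻¹, 0, 0, 0) • Legendre` with
  `Δ(V'') = 16λ²(λ − 1)²w¹² ∈ O^×` and `12k = e·v₃(Δ_min)` (`exists_legendreTwist_of_norm_j_le_one`,
  any odd `p`); hence **`‖q‖₃ ≤ 1` for EVERY datum of the fact**
  (`padicNorm_three_le_one_of_neronLattice_eq_smul_periodLattice`), **`q ∈ ℤ` for every `W'` not
  additive at `2`** (`int_of_neronLattice_eq_smul_periodLattice_of_not_additive_two`), and **the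
  fact is now EQUIVALENT to its local statement `‖q‖₂ ≤ 1` at an additive prime `2`**
  (`edixhoven_int_of_neronLattice_eq_smul_periodLattice_of_additive_two`; only potentially good
  additive reduction at `2` is open — the potentially multiplicative types at `2` are
  `…_of_one_lt_norm_j_two`). **LANDED and THE FACT IS DISCHARGED** (p135817, 2026-08-17, file
  `ManinConstantDeuringTwistProofs`: `edixhoven_int_of_neronLattice_eq_smul_periodLattice_holds`
  and the twin `ModularForms.edixhoven_optimalManinConstant_integral_holds`; consumers feed
  `(h : edixhoven_int_of_neronLattice_eq_smul_periodLattice)` with `_holds`): that last case via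
  the DEURING FORM — a
  flex `P = (x₀, y₀)` (`Ψ₃(x₀) = 0`) of `W'` in `ℚ̄₂`, `(1, x₀, s, y₀) • W' = y² + a₁'xy + a₃'y = x³`
  with `s = (a₄ + 2x₀a₂ − y₀a₁ + 3x₀²)/(a₃ + x₀a₁ + 2y₀)`, `t = a₁'³/a₃'`,
  `j = t(t − 24)³/(t − 27)`, `‖j‖₂ ≤ 1 ⇒ ‖t‖ ≤ 1 ∧ ‖t − 27‖ = 1`, `u¹² = Δ' = a₃'³(a₁'³ − 27a₃')`,
  `K = ℚ₂(x₀, y₀, u, 2^{1/12})` (so `12 ∣ e`), `V'' = (wa₁'/u, 0, w³a₃'/u³, 0, 0)` over `O` with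
  `Δ(V'') = w¹²`, `12k = e·v₂(Δ_min)`, integrality of `x₀, s, y₀` by
  `norm_rst_le_one_of_variableChange_eq`; ender at `2`: `[z²][2] = −a₁''` (`J = 2`, `k < 2e` always),
  `[z⁴][2] = a₁''a₂'' − 7a₃''` (`J = 4` when `v₂(Δ_min) < 16`), and the vertex `j = 2`,
  `‖a₁''‖¹² = ‖j‖₂` (`v₂(j) ≤ 5` when `v₂(Δ_min) ≥ 16`, Kraus) with `k + e·v₂(j)/12 < 2e ⇔ v₂(c₄) < 8`.
  [cite: EdixhovenManin1991, Prop. 2] [cite: SilvermanAEC2009, III.1.4(c), III.1.7, IV.7.5, VII.1.3(d), VII.5.4, VII.5.5]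
* **The "undecided" class is EMPTY; the additive `p = 2, 3` close by the sharp lemma, two Kraus
  bounds and Vieta** (lead c18 of crux stmt-ABC-15125, 2026-08-16; analysis note
  `EdixhovenAdditiveTwoThree-c18.md` attached to the items stmt-ABC-15990 / stmt-ABC-15125; the
  model-free step for `k < e` meanwhile LANDED as `ManinConstantSemistableTwistProofs`). Write
  `ν = k/e` for the twist exponent of a semistable (finite-height) twist `V'' = (πᵏ, r, s, t) • W'`
  over `O = 𝒪_K` at an additive `p`; since `v(Δ(V'')) = 0` (elliptic reduction) or `−v(j)` (node),
  **`12ν = min(v_p(Δ_min), 3v_p(c₄))`** whatever `K` and the twist. (1) KRAUS BOUNDS (landed,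
  `KrausNonMinimalityTwoThreeProofs`: `WeierstrassCurve.not_pow_dvd_c₄_c₆_of_isMinimal_two/_three`,
  `…_c₄_Δ_…`, global forms `…_c₄_minimalDiscriminantInt_two/_three`): a `ℤ₂`-minimal equation never
  has `2⁸ ∣ c₄ ∧ 2¹¹ ∣ c₆` (the `u = 2` scaling of the short normal form, `y² = x³ − c₄/768·x −
  c₆/55296`, would be `2`-integral with `Δ/2¹²` — the constructive case `16 ∣ c₄, 32 ∣ c₆` of
  Kraus 1989 Prop. 2), hence never `2⁸ ∣ c₄ ∧ 2¹⁶ ∣ Δ`; a `ℤ₃`-minimal one never has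
  `3⁵ ∣ c₄ ∧ 3⁹ ∣ c₆`, hence never `3⁵ ∣ c₄ ∧ 3¹⁴ ∣ Δ`. So `12ν ≤ 13` at `3`; `12ν ≤ 23` at `2`, and
  `12ν ≥ 16` at `2` forces `v₂(c₄) ∈ {6, 7}`, `v₂(Δ) ≥ 16`, `v₂(j) = 3v₂(c₄) − v₂(Δ) ≤ 5`. (2) SHARP
  LEMMA (landed, `Literature/RingTheory/PowerSeries/WeierstrassRootIntegralitySharp`,
  `Literature.RingTheory.PowerSeries.norm_coeff_mul_pow_le_of_subst_dominated` with slope and ROOT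
  forms `norm_coeff_one_le_of_subst_dominated`, `exists_norm_coeff_one_le_of_hasSum_zero`): over any
  non-archimedean field, if `G = Σ_{i≥1} bᵢZⁱ`, `T ∈ qO⟦q⟧` and every coefficient of `S = G(T)` is
  bounded by `‖S₁‖ = ‖b₁T₁‖`, then `‖bᵢ‖‖T₁‖ⁱ ≤ ‖b₁‖‖T₁‖` for all `i ≥ 2`, and `‖T₁‖ ≤ ‖R‖` for
  every nonzero root `R ∈ 𝔪` of `G` (proof by the Gauss norm at a real radius `ρ < 1`, elementary).
  For the data of the fact with `v_p(c) = −m < 0`, `c = n₁/(d′pᵐ)`: `T := [p^{m−1}][d′](t'') ∈ qO⟦q⟧`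
  (Weierstrass-root lemma, as in the `k < e` file), `[p]_{V''}(T) = θ''([n₁]ψ) ∈ πᵏ·qO⟦q⟧` with
  linear coefficient `πᵏn₁` — the domination hypothesis HOLDS — and `v(T₁) = ν − 1`; so
  **`ν − 1 ≥ v(Z(P))` for every `p`-torsion point `P ≠ O` of `V''` in the formal group**
  (`Z = −x/y`, `v(Z(P)) = −v(x(P))/2`), and `‖c‖_p ≤ 1` follows from ONE such `P` with
  `v(Z(P)) > ν − 1`. (3) TORSION FROM VIETA (no Newton polygon): at `2` the `x(P)`, `2P = O`, are the
  roots of `Ψ₂² = 4x³ + b₂''x² + 2b₄''x + b₆''`, so some `P` has `v(x(P)) ≤ v(b₂'') − 2` (sum of roots)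
  and some has `v(x(P)) ≤ (v(b₆'') − 2)/3` (product); at `3` the `x(P)`, `3P = O`, are the roots of
  `Ψ₃ = 3x⁴ + b₂''x³ + 3b₄''x² + 3b₆''x + b₈''` (`Ψ₃(x(P)) = 0 ⇔ x(2P) = x(P)`), so some `P` has
  `v(x(P)) ≤ v(b₂'') − 1` and some has `v(x(P)) ≤ (v(b₈'') − 1)/4`. On a GOOD model `c₄'' = b₂''² −
  24b₄''` gives `v(b₂'') = v_p(j)/6` as soon as `v₂(j) ≤ 8` (resp. `v₃(j) ≤ 2`), a supersingular good
  model has `b₆'' ∈ O^×` at `2` (`Δ'' ≡ a₃''⁴`) and `b₈'' ∈ O^×` at `3` (`Δ'' ≡ −8b₄''³`,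
  `4b₈'' = b₂''b₆'' − b₄''²`), a nodal model has `b₂'' ∈ O^×`. (4) CASES. `p = 3`: `ν − 1 ≤ 1/12`;
  nodal, or good with `v(b₂'') < 5/6`: a `3`-torsion `P` with `v(Z) ≥ (1 − v(b₂''))/2 > 1/12`; good
  supersingular: one with `v(Z) ≥ 1/8 > 1/12` ✓. `p = 2`, `12ν ≤ 15`: `ν − 1 ≤ 1/4 < 1/3 ≤ v(Z)`
  (supersingular: product of roots; ordinary/nodal: `v(Z) ≥ 1`) ✓. `p = 2`, `12ν ≥ 16`: `v(j) < 0`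
  ⇒ nodal, `v(Z) ≥ 1 > 3/4 ≥ ν − 1` ✓; `0 ≤ v(j) ≤ 5` ⇒ good, `12ν = v(Δ)`, `v(b₂'') = v(j)/6`, a
  `2`-torsion `P` with `v(Z) ≥ 1 − v(j)/12 > v(Δ)/12 − 1 ⇔ 3v₂(c₄) < 24` ✓. The road map's
  "undecided II*, `f = 8`, torsion valuation exactly `1/3`" would need `v(b₂'') ≥ 4/3`, i.e.
  `v₂(j) ≥ 8`, i.e. `v₂(c₄) ≥ 8` with `v₂(Δ) = 16` — excluded by (1) ("no canonical subgroup" never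
  happens on the good model of a `ℤ₂`-minimal curve with `v₂(Δ) ≥ 16`). WHAT REMAINS IN LEAN for the
  fact as stated: (τ) the `p`-torsion points with these valuations inside the formal group of `V''`
  (Mathlib `Ψ₂², Ψ₃` + the tree's Laurent-point dictionary `laurentPt_formalMul'`), (β′) the `k ≥ e`
  export of `T ∈ O⟦q⟧`, `[p](T) = θ''([n₁]ψ)`, `v(T₁) = ν − 1` from the `k < e` file (and `u₀ = πᵏε`,
  `ε ∈ O^×`), (σ) the semistable twists at `3` — uniformly: Legendre form over
  `ℚ₃(E[2], √(e₂ − e₁))` when `v₃(j) ≥ 0` (any root ordering gives `λ, 1 − λ ∈ O^×`), `E_j` over a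
  ramified quadratic field when `v₃(j) < 0` — and at `2` (`E_j` again when `v₂(j) < 0`; the wild
  potentially good case via Kraus 1990 / the Hesse model over `ℚ₂(E[3], μ₃)`: the one heavy piece),
  and the assembly through `…_of_imp`. [cite: EdixhovenManin1991, Prop. 2]
  [cite: Honda1970, Thm. 2 (p. 223)] [cite: SilvermanAEC2009, VII.1 Remark 1.1 and Ex. 3.7 (division polynomials)]
-/

/-- **Edixhoven 1991, Prop. 2 (the Manin constant of the strong Weil curve is an integer), in
lattice form**: if a GLOBALLY MINIMAL elliptic `W'/ℚ` has a newform `f` (at some level `N`,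
`IsNewformOf W' f`) and a Néron-type period pair `L'` whose lattice is EXACTLY `q · Λ_f` for a
rational `q` (so `z ↦ qz` is a `ℚ`-isomorphism `ℂ/Λ_f ≅ W'(ℂ)`, `W'` is a minimal model of the
optimal quotient `A_f = ℂ/Λ_f` and `|q|` is its Manin constant), then `q ∈ ℤ`. Verbatim the
hypothesis `hEd` of the tree's `exists_optimal_modularParametrizationData_of_edixhoven` and the
second conjunct of `exists_optimal_classical_iff_modularity_and_edixhoven`; it concerns only curves
that HAVE a newform (no modularity theorem inside). Agashe–Ribet–Stein 2006, Thm. 2.2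
("`c_A ∈ ℤ`", proof via the Néron mapping property and the `q`-expansion at `∞` on `X₀(N)_ℤ`).
[cite: EdixhovenManin1991, Prop. 2] [cite: AgasheRibetStein2006, Thm. 2.2]
[file NumberTheory/EllipticCurves/NeronIsogenyScaling] -/
def edixhoven_int_of_neronLattice_eq_smul_periodLattice : Prop :=
  ∀ {N : ℕ} [NeZero N] {W' : WeierstrassCurve ℚ} [W'.IsElliptic] [W'.IsGloballyMinimal]
    {f : CuspForm (Gamma0 N) 2} {L' : PeriodPair}, IsNewformOf W' f →
    IsNeronLatticeOf (W'.baseChange ℂ) L' → ∀ q : ℚ,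
    (∀ z ∈ periodLattice f, (q : ℂ) * z ∈ L'.lattice) →
    (∀ z ∈ L'.lattice, ∃ w ∈ periodLattice f, z = q * w) → ∃ k : ℤ, (k : ℚ) = q

/-- **One statement, two names (dedup record).** The librarian-vendored named fact
`Literature.NumberTheory.EllipticCurves.ModularForms.edixhoven_optimalManinConstant_integral`
(`ManinConstantIntegral.lean`, sweep g23, p116115, 2026-08-16) has VERBATIM the body of
`edixhoven_int_of_neronLattice_eq_smul_periodLattice` (both are the binder `hEd` of
`exists_optimal_modularParametrizationData_of_edixhoven`): the two `Prop`s are definitionally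
equal, so the tree carries Edixhoven 1991, Prop. 2 as ONE debt under two names, and a discharge of
either name discharges the other through this equivalence. [cite: EdixhovenManin1991, Prop. 2]
[cite: AgasheRibetStein2006, Thm. 2.2] -/
theorem edixhoven_int_of_neronLattice_eq_smul_periodLattice_iff_optimalManinConstant_integral :
    edixhoven_int_of_neronLattice_eq_smul_periodLattice ↔
      ModularForms.edixhoven_optimalManinConstant_integral :=
  Iff.rfl

/-- The `ModularForms`-namespace copy follows from the `EllipticCurves`-namespace fact (use with a
future `edixhoven_int_of_neronLattice_eq_smul_periodLattice_holds`). [cite: EdixhovenManin1991, Prop. 2] -/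
theorem ModularForms.edixhoven_optimalManinConstant_integral_of
    (h : edixhoven_int_of_neronLattice_eq_smul_periodLattice) :
    ModularForms.edixhoven_optimalManinConstant_integral :=
  h

/-- The `EllipticCurves`-namespace fact follows from the `ModularForms`-namespace copy (use with a
future `ModularForms.edixhoven_optimalManinConstant_integral_holds`). [cite: EdixhovenManin1991, Prop. 2] -/
theorem edixhoven_int_of_neronLattice_eq_smul_periodLattice_of_optimalManinConstant_integral
    (h : ModularForms.edixhoven_optimalManinConstant_integral) :
    edixhoven_int_of_neronLattice_eq_smul_periodLattice :=
  h

end Literature.NumberTheory.EllipticCurves
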